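import Summits.AnomalousDissipation.AnomalousDissipation.Theorems.MomentLadder.Negative.Clauses
import Summits.AnomalousDissipation.AnomalousDissipation.Theorems.MomentParityMomentClosure
import Literature.Analysis.FunctionSpaces.TorusEnstrophyTrilinear
import Literature.Analysis.FunctionSpaces.TorusTruncationH1
import Literature.Analysis.FluidPDE.ZerothLaw

/-!
# Moment closure at every degree: stub `stub_closureAllDegrees` of line `Sketch`
# (crux `MomentParity.MomentLadder`, stmt-AnomalousDissipation-11463)

At fixed `(f, ν, N, E, ε, R, κ)`, ladder witnesses `μ_d` for every moment order `d` (level-`N`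
probability laws on `H = L²_σ(T³)`, supported in `‖u‖ ≤ R`, `κ`-resolved, `d`-stationary for
Galerkin NS at `(ν, f)`, mean energy `≤ E`, dissipation `≥ ε`) give ONE law with the same level,
support, resolution schedule, energy and dissipation bounds that is polynomially stationary at EVERY
degree. Proof: the internal lemmas of the landed `momentClosure_proof` (stmt-11467) — every `μ_d` is
carried by the compact level ball `K = {u level-N, ‖u‖ ≤ R}` (`isCompact_levelBall`); a weak-* cluster
point `μ'` (`exists_limit_measure_of_isCompact`) inherits every closed constraint on the mean of a
continuous functional that holds eventually in `d`; the tail schedule (`tail_iff`, continuous band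
enstrophies), the polynomial rows (continuous tested generators, valid for `μ_d` once `d > deg P`),
the energy and the dissipation are such constraints. The `C¹` upgrade of `momentClosure_proof` is
not needed here.
-/

set_option linter.dupNamespace false

noncomputable section

namespace Summit.AnomalousDissipation.AnomalousDissipation.Theorems.MomentLadder

open MeasureTheory Filter Topology Set
open scoped ENNReal NNReal InnerProductSpace RealInnerProductSpace Polynomial
open Literature.Analysis.FunctionSpaces Literature.Analysis.FluidPDE
open Summit.AnomalousDissipation.AnomalousDissipation.Theses.MomentParity
open Summit.AnomalousDissipation.AnomalousDissipation.Theorems.QuarticGate.Negative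
open Summit.AnomalousDissipation.AnomalousDissipation.Theorems.MomentLadder.Negative
open Summit.AnomalousDissipation.AnomalousDissipation.Theorems.MomentParityMomentClosure

/-- STUB B1 (reshape r3): MOMENT CLOSURE AT EVERY DEGREE — at fixed `(f, ν, N, E, ε, R, κ)`, ladder
witnesses for every order `d` give ONE law with the same level, support, resolution schedule, energy
and dissipation bounds that is polynomially stationary at EVERY degree (weak-* compactness on the
compact level ball; the internal lemmas of the landed `momentClosure_proof`, stmt-11467). [folklore] -/
theorem stub_closureAllDegrees :
    ∀ (f : UnitAddTorus (Fin 3) → EuclideanSpace ℝ (Fin 3)), Torus.IsSmooth f →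
      ∀ (ν : ℝ) (N : ℕ) (E ε R : ℝ) (κ : ℕ → ℕ),
        (∀ d : ℕ, ∃ μ : Measure (Torus.energySpace (Fin 3)), IsLadderWitness f ν N E ε R κ d μ) →
        ∃ μ : Measure (Torus.energySpace (Fin 3)), IsProbabilityMeasure μ ∧ (∀ᵐ u ∂μ, IsLevel N u) ∧
          IsSupported R μ ∧ IsResolved κ μ ∧ (∀ d, IsPolyStationary ν f N d μ) ∧
          Torus.ensembleEnergy μ ≤ E ∧ ε ≤ Torus.ensembleDissipation ν μ := by
  intro f hfs ν N E ε R κ hd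
  -- name the seven clauses of the witnesses (`IsLadderWitness` unfolds definitionally)
  choose μ hμP hμL hμR hμT hμS hμE hμD using
    (hd : ∀ d : ℕ, ∃ μ : Measure (Torus.energySpace (Fin 3)), IsProbabilityMeasure μ ∧
      (∀ᵐ u ∂μ, IsLevel N u) ∧ IsSupported R μ ∧ IsResolved κ μ ∧ IsPolyStationary ν f N d μ ∧
      Torus.ensembleEnergy μ ≤ E ∧ ε ≤ Torus.ensembleDissipation ν μ)
  have hf : Integrable f volume := hfs.integrable
  -- the support radius is nonnegative (the measures are probability measures)
  have hR : 0 ≤ R := by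
    haveI := hμP 0
    obtain ⟨u, hu⟩ := (hμR 0).exists
    exact (norm_nonneg u).trans hu
  -- 1. the compact carrier
  set K : Set (Torus.energySpace (Fin 3)) :=
    {u | CubicParityLoud.Negative.IsLevel N u ∧ ‖u‖ ≤ R}
  have hK : IsCompact K := isCompact_levelBall N hR
  have hμK : ∀ d, ∀ᵐ u ∂μ d, u ∈ K := fun d => (hμL d).and (hμR d)
  -- 2. the limit measure
  obtain ⟨μ', hμ'P, hμ'K, hlim⟩ := exists_limit_measure_of_isCompact hK μ hμP hμK
  haveI := hμ'P
  haveI : ∀ d, IsProbabilityMeasure (μ d) := hμP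
  refine ⟨μ', hμ'P, hμ'K.mono fun u hu => hu.1, hμ'K.mono fun u hu => hu.2, ?_, ?_, ?_, ?_⟩
  · -- 3a. the tail schedule
    intro n
    rw [tail_iff hR hμ'K (κ n) n]
    refine hlim _ ((continuous_bandEnstrophy _).sub (continuous_bandEnstrophy _)) (Set.Iic _)
      isClosed_Iic (Eventually.of_forall fun d => ?_)
    exact (tail_iff hR (hμK d) (κ n) n).1 (hμT d n)
  · -- 3b. generator rows at EVERY degree: polynomial tests pass to the limit
    intro d m g P hg _hdeg
    have hgs : ∀ i, Torus.IsSmooth (g i) := fun i => (hg i).1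
    refine ⟨integrable_of_continuous_of_ae_mem hK hμ'K
      (continuous_nsGeneratorPairing_polyGrad ν hf hgs P), ?_⟩
    refine hlim _ (continuous_nsGeneratorPairing_polyGrad ν hf hgs P) {0} isClosed_singleton ?_
    filter_upwards [eventually_ge_atTop (P.totalDegree + 1)] with d' hd'
    exact (hμS d' m g P hg hd').2
  · -- 3c. mean energy
    exact hlim (fun u : Torus.energySpace (Fin 3) => ‖u‖ ^ 2) (continuous_norm.pow 2) (Set.Iic E)
      isClosed_Iic (Eventually.of_forall fun d => hμE d)
  · -- 3d. dissipation
    have hcl : IsClosed {t : ℝ | ε ≤ ν * t} :=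
      isClosed_le continuous_const (continuous_const.mul continuous_id)
    have key := hlim _ (continuous_bandEnstrophy (Torus.freqBall N)) _ hcl
      (Eventually.of_forall fun d => by
        have h := hμD d
        rw [Torus.ensembleDissipation, Torus.ensembleEnstrophy, lintegral_eGradNormSq_eq hR (hμK d),
          ENNReal.toReal_ofReal (integral_nonneg (bandEnstrophy_nonneg _))] at h
        exact h)
    rw [Torus.ensembleDissipation, Torus.ensembleEnstrophy, lintegral_eGradNormSq_eq hR hμ'K,
      ENNReal.toReal_ofReal (integral_nonneg (bandEnstrophy_nonneg _))]
    exact key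

end Summit.AnomalousDissipation.AnomalousDissipation.Theorems.MomentLadder

end
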